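import Literature.AlgebraicGeometry.Hassett2000.CubicScrollLoci
import HarnessLib

/-!
# HodgeLocusCensusDetScrollCount — engine B's determinantal parameter count of the cubic-scroll locus `W_k`
# equals the Hilbert-scheme count of `Hassett2000/CubicScrollLoci`, for EVERY `k ≥ 1`
# (cell pub-hlocus, lead gen 7; ivhs-2 GENERIC-EXCESS-g10 §0ter (vii), lead countersign)
HONEST FRAMING: certified instances and evidence bearing on the general Hodge conjecture; no claim.

Engine B (ivhs-2, gen 10) parametrises the locus `W_k` of cubic `2k`-folds containing a `2×3`-determinantal cubic
`k`-fold scroll by a `ℙ^{k+2} ⊂ ℙ^{2k+1}` together with a `3×3` matrix of linear forms on it whose determinant is the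
restriction of the cubic, and records the expected codimension
`detScrollLocusCodim k = [C(k+5,3) − 9k − 11] − (k+3)(k−1)`: cubics on `ℙ^{k+2}` (projective dimension `C(k+5,3) − 1`)
modulo the `(9k+10)`-dimensional family of `3×3` linear determinants (`9(k+3)` coefficients, projectively, modulo the
`16`-dimensional effective action of `GL₃ × GL₃`), minus `dim G(k+3, 2k+2) = (k+3)(k−1)`.  The Literature file
`Hassett2000/CubicScrollLoci` carries the Hilbert-scheme count `scrollLocusCodim k = h⁰(𝒪_S(3)) − (k²+8k+3) + 2` and the
EXCESS IDENTITY `planePairLocusCodim k − scrollLocusCodim k = k − 1`.  Below: the two counts AGREE for every `k ≥ 1`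
(a cubic polynomial identity in `k`), so B's "codim W_k = codim 𝒩_k − (k−1) identically in k" (§0ter (vii), checked there
numerically for `k ≤ 11`) is a statement about closed forms proved once and for all; the instances
`k = 2,…,7 ↦ 1, 6, 16, 32, 55, 86` are the census ranks `rank M_{[Π₁]−[Π₂]}` of the cubic difference rows.
BOOKKEEPING ONLY: nothing is asserted here about the actual dimension of `W_k` or of any Hodge locus.
-/

namespace Summit.HodgeConjecture.HodgeConjecture.HodgeLocus.Census

open Literature.AlgebraicGeometry.Hassett2000

/-- Expected codimension, in `ℙ(S_3(ℙ^{k+2}))`, of the cubics that are a `3×3` linear determinant: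
`C(k+5,3) − 1 − (9(k+3) − 17) = C(k+5,3) − 9k − 11` (parameter count). -/
def detCubicCodim (k : ℕ) : ℤ := ((k + 5).choose 3 : ℤ) - 9 * k - 11

/-- `dim G(k+3, 2k+2) = (k+3)(k−1)`, the linear `ℙ^{k+2}`'s in `ℙ^{2k+1}`. -/
def spanGrassDim (k : ℕ) : ℤ := ((k : ℤ) + 3) * ((k : ℤ) - 1)

/-- Engine B's expected codimension of the determinantal cubic-scroll locus `W_k` among cubic `2k`-folds
(GENERIC-EXCESS-g10 §0ter (vii)). -/
def detScrollLocusCodim (k : ℕ) : ℤ := detCubicCodim k - spanGrassDim k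

/-- Values `k = 2,…,8 ↦ 1, 6, 16, 32, 55, 86, 126` (`k ≤ 7`: the census ranks at `λ = −1`, rows S and the two-block
difference rows; `k = 2`: Hassett's divisor `𝒞₁₂`). -/
theorem detScrollLocusCodim_table :
    detScrollLocusCodim 2 = 1 ∧ detScrollLocusCodim 3 = 6 ∧ detScrollLocusCodim 4 = 16 ∧ detScrollLocusCodim 5 = 32 ∧
    detScrollLocusCodim 6 = 55 ∧ detScrollLocusCodim 7 = 86 ∧ detScrollLocusCodim 8 = 126 := by
  decide

/-- Closed form: `6 · detScrollLocusCodim (j+1) = j((j+1)² + 7(j+1) − 12)`. -/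
theorem six_mul_detScrollLocusCodim (j : ℕ) :
    6 * detScrollLocusCodim (j + 1) = (j : ℤ) * ((j + 1) ^ 2 + 7 * (j + 1) - 12) := by
  unfold detScrollLocusCodim detCubicCodim spanGrassDim
  have h3 : ((j + 6).choose 3 : ℤ) * 6 = (j + 6) * (j + 5) * (j + 4) := by
    have := Nat.choose_mul_factorial_mul_factorial (show 3 ≤ j + 6 by omega)
    rw [show j + 6 - 3 = j + 3 from by omega] at this
    have h : ((j + 6).choose 3) * 6 * (j + 3).factorial = (j + 6) * (j + 5) * (j + 4) * (j + 3).factorial := by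
      have e : (j + 6).factorial = (j + 6) * (j + 5) * (j + 4) * (j + 3).factorial := by
        rw [show j + 6 = (j + 5) + 1 from rfl, Nat.factorial_succ, show j + 5 = (j + 4) + 1 from rfl,
          Nat.factorial_succ, show j + 4 = (j + 3) + 1 from rfl, Nat.factorial_succ]; ring
      rw [← e, ← this, show (3 : ℕ).factorial = 6 from rfl]
    have hj : (j + 3).factorial ≠ 0 := Nat.factorial_ne_zero (j + 3)
    exact_mod_cast Nat.eq_of_mul_eq_mul_right (Nat.pos_of_ne_zero hj) h
  rw [show j + 1 + 5 = j + 6 from by ring]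
  push_cast
  linear_combination h3

/-- THE TWO PARAMETER COUNTS AGREE for every `k ≥ 1`: engine B's determinantal count = the Hilbert-scheme count of
`Hassett2000/CubicScrollLoci` (`scrollLocusCodim`). -/
theorem detScrollLocusCodim_eq_scrollLocusCodim (j : ℕ) :
    detScrollLocusCodim (j + 1) = scrollLocusCodim (j + 1) := by
  have h : 6 * detScrollLocusCodim (j + 1) = 6 * scrollLocusCodim (j + 1) := by
    rw [six_mul_detScrollLocusCodim, six_mul_scrollLocusCodim]
  omega

/-- Hence the excess identity in B's parametrisation: `codim 𝒩_k − codim W_k = k − 1` for every `k ≥ 1`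
(`planePairLocusCodim` = codimension of cubics containing two `k`-planes meeting in a `ℙ^{k−2}`). -/
theorem planePairLocusCodim_sub_detScrollLocusCodim (j : ℕ) :
    planePairLocusCodim (j + 1) - detScrollLocusCodim (j + 1) = j := by
  have h := excess_eq j
  unfold excess at h
  rw [detScrollLocusCodim_eq_scrollLocusCodim]
  exact h

end Summit.HodgeConjecture.HodgeConjecture.HodgeLocus.Census
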